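/-
Copyright (c) 2026 the pub-hodgecm-mathlib formalisation cell (harness21).  Prover seat hodgecm-mathlib-K2Liu-p02 (g7), Track B «K2-LIT» ∕ hLiu418
#184♮, #42S payer road (σ), V5-inst (f) PART 2b file 2b — the unipotent pins `nΔ`, `hnΔ` and the DUAL TABLE `η ↦ h(η)` of the hermitian moment
coordinates `qHerm` at `n = 2` (K2Liu-p02 (g7) bus 14:08∕14:5xZ).  DEFINITION LANE (`hMat`, `tMat`, `nDeltaLoc`) + theorems.
-/
import Summits.HodgeConjecture.HodgeConjecture.Theorems.K2LiuA7ValueUnipotentPinsHerm          -- ★ p860905 (`qHerm`)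
import Summits.HodgeConjecture.HodgeConjecture.Theorems.K2LiuDeltaSpTransportUnipotentValue   -- ★ p860927 (`half_deltaGram_reFrame_tensor`)
import Literature.NumberTheory.K2Lit.LocalSiegelIntertwining                                -- ★ D10 `unipDeltaLocal`, `nElem_mem_unipDeltaLocal`
import Literature.NumberTheory.GelbartRogawski1991.DoubledWeilRepresentationArchLagrangian     -- ★ `isUnit_det_gramR₀`
import HarnessLib

/-!
# Crux `HLiu418`, (σ) V5-inst (f), file 2b: THE UNIPOTENT PINS `nΔ η = n(S₀⁻¹ h(η))` OF THE SMALL GROUP `U(𝔻)(L⁺_v)` (`n = 2`, `ι = Fin 4`) AND THE DUALITY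
# `im Σᵢⱼ h(η)ᵢⱼ Gᵢⱼ = −η ⬝ᵥ qHerm` WITH THE HERMITIAN MOMENT COORDINATES

Cell `hodgecm-mathlib`, crux item hLiu418 = `stmt-HodgeConjecture-24832`; squad K2 ∕ K2Liu; prover K2Liu-p02 (g7).  DEFINITION LANE: three `def`s (`hMat`, `tMat`,
`nDeltaLoc` — the `nΔ` socket of `faceA4R_two_of_record`); everything else theorems; no instance, no notation, no `sorry`; lane `--supports stmt-HodgeConjecture-24832 --as helper`.
`δ := imagUnit L` (the instance's quadratic coordinates, as ★ I-2∕I-3), small Gram block `S₀ = gramS (gramR)` (★ D10), `hJD := hermD_eq_map_gramD`.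

* §1 **`hMat η`** — the skew-hermitian `2 × 2` matrix over `L ⊗ L⁺_v` with quadratic coordinates `h₀₀ = (0, −η₀)`, `h₁₁ = (0, −η₁)`, `h₀₁ = (−½η₃, −½η₂)`, `h₁₀ = (½η₃, −½η₂)`
  (`hMat_conjTranspose : (h^σ)ᵀ = −h`); **`tMat η := S₀⁻¹ h(η)`** is `S₀`-skew (`tMat_skew`, the hypothesis of ★ `nElem`); **`nDeltaLoc η := nElem (tMat η)`** (= V8e's `nΔ`) and
  **`nDeltaLoc_mem_unipDeltaLocal`** (= `hnΔ`, ★ `nElem_mem_unipDeltaLocal`).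
* §2 THE DUALITY: for a `σ`-hermitian `G`, **`im_sum_hMat_mul : im( Σᵢⱼ h(η)ᵢⱼ Gᵢⱼ ) = −(η ⬝ᵥ (re G₀₀, re G₁₁, re G₀₁, im G₀₁))`**; with ★ p860927 `half_deltaGram_reFrame_tensor`
  (`⅟2 β_Δ(R b, R (T b)) = im Σ (S₀ t)ᵢⱼ (gramLoc b)ᵢⱼ`, `S₀ · tMat η = hMat η`) and ★ p860905 `qHerm`: **`half_deltaGram_reFrame_tensor_tMat : ⅟2 β_Δ(R b, R (T_η b)) = −(η ⬝ᵥ qHerm (R b))`**,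
  `T_η = reindex epsV (tMat η ⊗ₖ 1)` — so ★ A2d's `unipotentOp ψ q f x = ψ(−q x) f x` gives EXACTLY `ψ(η ⬝ᵥ qHerm x)`: the `hN` socket up to the splitting scalar (file 2c).
References: [Kudla1994] §3 Thm. 3.1; [Weil1964] n° 6, n° 13; [MoeglinVignerasWaldspurger1987] Chap. 2 II.6; [KudlaRallis1994] §2.
HONEST LABEL.  Count-neutral helper: `HC_CM` is proved only modulo the 7 printed citations (2 remaining named inputs: hLiu418 = `stmt-HodgeConjecture-24832`,
h413 = `stmt-HodgeConjecture-24833`) until rung 0 closes.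
-/

set_option autoImplicit false
set_option linter.dupNamespace false -- the mandated namespace repeats `HodgeConjecture.HodgeConjecture`
set_option synthInstance.maxHeartbeats 200000 -- rectangular matrix products over the Π-type `L ⊗ L⁺_v` (as ★ p860598)

noncomputable section

open scoped Matrix Kronecker
open Matrix
open NumberField IsDedekindDomain
open Literature.NumberTheory.Automorphic Literature.NumberTheory.Automorphic.UnitaryGroup
open Literature.NumberTheory.Automorphic.UnitaryGroup.QuadraticCoordinates
open Literature.RepresentationTheory.HeisenbergGroup
open Literature.NumberTheory.GelbartRogawski1991 Literature.NumberTheory.GelbartRogawski1991.AdaptedBlocks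
open Literature.NumberTheory.GelbartRogawski1991.GRConstruction
open Literature.NumberTheory.GelbartRogawski1991.UnitaryDualPair
open Literature.NumberTheory.GelbartRogawski1991.UnitaryDualPair.LocalSplitting
open Literature.NumberTheory.K2Lit.SiegelDoubled Literature.NumberTheory.K2Lit.LocalSiegelDoubled
open Summit.HodgeConjecture.HodgeConjecture.Cruxes.HLiu418.K2LiuDeltaModelRealFrame
open Summit.HodgeConjecture.HodgeConjecture.Cruxes.HLiu418.K2LiuLocalSWSectionDefs
open Summit.HodgeConjecture.HodgeConjecture.Cruxes.HLiu418.K2LiuA7ValueUnipotentPins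
open Summit.HodgeConjecture.HodgeConjecture.Cruxes.HLiu418.K2LiuA7ValueUnipotentPinsHerm
open Summit.HodgeConjecture.HodgeConjecture.Cruxes.HLiu418.K2LiuDeltaSpTransportUnipotentValue

namespace Summit.HodgeConjecture.HodgeConjecture.Cruxes.HLiu418.K2LiuA7ValueUnipotentPinsN

variable (L : Type) [Field L] [NumberField L] [IsCMField L] [Algebra.IsQuadraticExtension (Fp L) L]
variable {N M : ℕ} (e : Fin N × Fin M ≃ Fin 2)
  (dV : Fin N → L) (hdV : ∀ i, IsCMField.complexConj L (dV i) = dV i) (hdV0 : ∀ i, dV i ≠ 0)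
  (dW : Fin M → L) (hdW : ∀ i, IsCMField.complexConj L (dW i) = dW i) (hdW0 : ∀ i, dW i ≠ 0)
variable {M₂ M' n' : ℕ} (eW : Fin M × Fin M₂ ≃ Fin M') (e' : Fin N × Fin M' ≃ Fin n')
  (dV' : Fin M₂ → L) (hdV' : ∀ k, IsCMField.complexConj L (dV' k) = dV' k)
variable (v : HeightOneSpectrum (𝓞 (Fp L)))

/-! ## §1 The table `h(η)`, the skew element `t(η) = S₀⁻¹ h(η)` and the pins `nΔ η = n(t(η))` -/

/-- **THE DUAL TABLE `h(η)`**: the skew-hermitian `2 × 2` matrix over `L ⊗ L⁺_v` with quadratic coordinates (`δ = imagUnit`) `h₀₀ = (0, −η₀)`, `h₁₁ = (0, −η₁)`,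
`h₀₁ = (−½η₃, −½η₂)`, `h₁₀ = (½η₃, −½η₂)` — chosen so that `im Σ hᵢⱼ Gᵢⱼ = −η ⬝ᵥ (re G₀₀, re G₁₁, re G₀₁, im G₀₁)` (§2). [cite: Kudla1994, §3 Thm. 3.1] -/
def hMat (η : Fin 4 → v.adicCompletion (Fp L)) : Matrix (Fin 2) (Fin 2) (LocalRing L v) :=
  !![quadraticLocalEquiv L v (IsCMField.complexConj L) (complexConj_imagUnit L) (imagUnit_ne_zero L) (0, -η 0),
      quadraticLocalEquiv L v (IsCMField.complexConj L) (complexConj_imagUnit L) (imagUnit_ne_zero L) (-(⅟(2 : v.adicCompletion (Fp L)) * η 3), -(⅟(2 : v.adicCompletion (Fp L)) * η 2));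
    quadraticLocalEquiv L v (IsCMField.complexConj L) (complexConj_imagUnit L) (imagUnit_ne_zero L) (⅟(2 : v.adicCompletion (Fp L)) * η 3, -(⅟(2 : v.adicCompletion (Fp L)) * η 2)),
      quadraticLocalEquiv L v (IsCMField.complexConj L) (complexConj_imagUnit L) (imagUnit_ne_zero L) (0, -η 1)]

/-- `h(η)` is skew-hermitian: `(h^σ)ᵀ = −h` (`σ (a, b) = (a, −b)`, ★ `conjLocal_quadraticLocalEquiv`). [cite: Kudla1994, §3] -/
theorem hMat_conjTranspose (η : Fin 4 → v.adicCompletion (Fp L)) :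
    ((hMat L v η).map (conjLocal L (IsCMField.complexConj L) v))ᵀ = -hMat L v η := by
  ext i j
  fin_cases i <;> fin_cases j <;>
    simp only [hMat, Matrix.transpose_apply, Matrix.map_apply, Matrix.neg_apply, Matrix.of_apply, Matrix.cons_val', Matrix.cons_val_zero, Matrix.cons_val_one,
      Matrix.empty_val', Matrix.cons_val_fin_one, Fin.zero_eta, Fin.mk_one, conjLocal_quadraticLocalEquiv, ← map_neg, Prod.neg_mk, neg_neg, neg_zero]

omit [Algebra.IsQuadraticExtension (Fp L) L] in
include hdV0 hdW0 in
/-- `det S₀` is a unit (`S₀ = gramS (gramR)`, ★ `isUnit_det_gramS'` + ★ `isUnit_det_gramR₀`). [folklore] -/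
theorem isUnit_det_gramS_gramR : IsUnit (LocalSplitting.gramS (Fp L) L v 2 (gramR L e dV hdV dW hdW)).det :=
  isUnit_det_gramS' (Fp L) L v 2 (isUnit_det_gramR₀ L e dV hdV hdV0 dW hdW hdW0)

/-- **`t(η) := S₀⁻¹ · h(η)`** — the `S₀`-skew element with `S₀ t(η) = h(η)`. [cite: Kudla1994, §3] -/
def tMat (η : Fin 4 → v.adicCompletion (Fp L)) : Matrix (Fin 2) (Fin 2) (LocalRing L v) :=
  (LocalSplitting.gramS (Fp L) L v 2 (gramR L e dV hdV dW hdW))⁻¹ * hMat L v η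

include hdV0 hdW0 in
/-- `S₀ · t(η) = h(η)`. [cite: Kudla1994, §3] -/
theorem gramS_mul_tMat (η : Fin 4 → v.adicCompletion (Fp L)) :
    LocalSplitting.gramS (Fp L) L v 2 (gramR L e dV hdV dW hdW) * tMat L e dV hdV dW hdW v η = hMat L v η := by
  rw [tMat, ← Matrix.mul_assoc, Matrix.mul_nonsing_inv _ (isUnit_det_gramS_gramR L e dV hdV hdV0 dW hdW hdW0 v), Matrix.one_mul]

include hdV0 hdW0 in
/-- **`t(η)` is `S₀`-skew**: `(t^σ)ᵀ S₀ + S₀ t = 0` (the hypothesis of ★ `nElem`; `S₀` is real symmetric, `h` skew-hermitian). [cite: Kudla1994, §3] [cite: Weil1964, n° 32] -/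
theorem tMat_skew (η : Fin 4 → v.adicCompletion (Fp L)) :
    ((tMat L e dV hdV dW hdW v η).map (conjLocal L (IsCMField.complexConj L) v))ᵀ * LocalSplitting.gramS (Fp L) L v 2 (gramR L e dV hdV dW hdW) +
      LocalSplitting.gramS (Fp L) L v 2 (gramR L e dV hdV dW hdW) * tMat L e dV hdV dW hdW v η = 0 := by
  set S := LocalSplitting.gramS (Fp L) L v 2 (gramR L e dV hdV dW hdW) with hS
  have hSu := isUnit_det_gramS_gramR L e dV hdV hdV0 dW hdW hdW0 v
  have hSσ : S.map (conjLocal L (IsCMField.complexConj L) v) = S := gramS_map_conj (Fp L) L (IsCMField.complexConj L) v 2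
  have hST : Sᵀ = S := gramS_transpose (Fp L) L v 2 (gramR_isSymm L e dV hdV dW hdW)
  have hSinvσ : S⁻¹.map (conjLocal L (IsCMField.complexConj L) v) = S⁻¹ :=
    K2LiuLeviDeltaBlockDSurjective.map_conjLocal_nonsing_inv_of_map_eq L v hSσ hSu
  rw [gramS_mul_tMat L e dV hdV hdV0 dW hdW hdW0 v, tMat, Matrix.map_mul, hSinvσ, Matrix.transpose_mul, Matrix.transpose_nonsing_inv, hST, Matrix.mul_assoc,
    Matrix.nonsing_inv_mul _ hSu, Matrix.mul_one, hMat_conjTranspose, neg_add_cancel]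

/-- **THE PINS `nΔ η := n(t(η)) ∈ U(𝔻)(L⁺_v)`** (★ `nElem` at the K2Liu datum, `hJD := hermD_eq_map_gramD`) — the `nΔ` socket (`ι := Fin 4`) of `faceA4R_two_of_record`.
[cite: Kudla1994, §3 Thm. 3.1] [cite: Weil1964, n° 32] -/
def nDeltaLoc (hdV0 : ∀ i, dV i ≠ 0) (hdW0 : ∀ i, dW i ≠ 0) (η : Fin 4 → v.adicCompletion (Fp L)) :
    UnitaryGroup.localPi L (IsCMField.complexConj L) (2 + 2) (hermD L e dV hdV dW hdW) v :=
  nElem (Fp L) L (IsCMField.complexConj L) v 2 (hermD_eq_map_gramD L e dV hdV dW hdW) (tMat L e dV hdV dW hdW v η)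
    (tMat_skew L e dV hdV hdV0 dW hdW hdW0 v η)

/-- **`hnΔ`: the pins lie in `N_Δ(L⁺_v)`** (★ `nElem_mem_unipDeltaLocal`). [cite: Kudla1994, §3] -/
theorem nDeltaLoc_mem_unipDeltaLocal (η : Fin 4 → v.adicCompletion (Fp L)) :
    nDeltaLoc L e dV hdV dW hdW v hdV0 hdW0 η ∈ unipDeltaLocal (Fp L) L (IsCMField.complexConj L) v 2 (JD := hermD L e dV hdV dW hdW) :=
  nElem_mem_unipDeltaLocal (Fp L) L (IsCMField.complexConj L) v 2 (hermD_eq_map_gramD L e dV hdV dW hdW) _ _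

/-- the adapted matrix of `nΔ η` is `(1, t(η); 0, 1)` (★ `adapt_matA_nElem`). [cite: Kudla1994, §3] -/
theorem adapt_matA_nDeltaLoc (η : Fin 4 → v.adicCompletion (Fp L)) :
    adapt (matA (Fp L) L (IsCMField.complexConj L) v 2 (nDeltaLoc L e dV hdV dW hdW v hdV0 hdW0 η)) = Matrix.fromBlocks 1 (tMat L e dV hdV dW hdW v η) 0 1 :=
  adapt_matA_nElem (Fp L) L (IsCMField.complexConj L) v 2 (hermD_eq_map_gramD L e dV hdV dW hdW) _ _

/-! ## §2 The duality with the hermitian moment coordinates -/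

/-- **THE DUALITY**: for a `σ`-hermitian `G`, `im( Σᵢⱼ h(η)ᵢⱼ · Gᵢⱼ ) = −(η ⬝ᵥ (re G₀₀, re G₁₁, re G₀₁, im G₀₁))`. [cite: Kudla1994, §3 Thm. 3.1] [cite: KudlaRallis1994, §2] -/
theorem im_sum_hMat_mul (η : Fin 4 → v.adicCompletion (Fp L)) (G : Matrix (Fin 2) (Fin 2) (LocalRing L v))
    (hG : (G.map (conjLocal L (IsCMField.complexConj L) v))ᵀ = G) :
    im (quadraticLocalEquiv L v (IsCMField.complexConj L) (complexConj_imagUnit L) (imagUnit_ne_zero L)).toLinearEquiv.toAddEquiv (∑ i, ∑ j, hMat L v η i j * G i j) =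
      -(η ⬝ᵥ ![re (quadraticLocalEquiv L v (IsCMField.complexConj L) (complexConj_imagUnit L) (imagUnit_ne_zero L)).toLinearEquiv.toAddEquiv (G 0 0),
        re (quadraticLocalEquiv L v (IsCMField.complexConj L) (complexConj_imagUnit L) (imagUnit_ne_zero L)).toLinearEquiv.toAddEquiv (G 1 1),
        re (quadraticLocalEquiv L v (IsCMField.complexConj L) (complexConj_imagUnit L) (imagUnit_ne_zero L)).toLinearEquiv.toAddEquiv (G 0 1),
        im (quadraticLocalEquiv L v (IsCMField.complexConj L) (complexConj_imagUnit L) (imagUnit_ne_zero L)).toLinearEquiv.toAddEquiv (G 0 1)]) := by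
  have h := isQuadraticCoordinates_local L v (IsCMField.complexConj L) (complexConj_imagUnit L) (imagUnit_ne_zero L) (imagUnit_mul_self L)
  -- hermitian relations: `G₁₀ = σ G₀₁` (so `re G₁₀ = re G₀₁`, `im G₁₀ = −im G₀₁`)
  have h10 : G 1 0 = conjLocal L (IsCMField.complexConj L) v (G 0 1) := by
    have := congrFun (congrFun hG 1) 0
    rw [Matrix.transpose_apply, Matrix.map_apply] at this
    exact this.symm
  have hre10 := congrArg (re (quadraticLocalEquiv L v (IsCMField.complexConj L) (complexConj_imagUnit L) (imagUnit_ne_zero L)).toLinearEquiv.toAddEquiv) h10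
  have him10 := congrArg (im (quadraticLocalEquiv L v (IsCMField.complexConj L) (complexConj_imagUnit L) (imagUnit_ne_zero L)).toLinearEquiv.toAddEquiv) h10
  rw [re_conjLocal] at hre10
  rw [im_conjLocal] at him10
  simp only [Fin.sum_univ_two, map_add, h.im_mul, hMat, Matrix.of_apply, Matrix.cons_val', Matrix.cons_val_zero, Matrix.cons_val_one, Matrix.empty_val',
    Matrix.cons_val_fin_one, hre10, him10, dotProduct, Fin.sum_univ_four, Matrix.cons_val]
  simp only [show ∀ a b : v.adicCompletion (Fp L), re (quadraticLocalEquiv L v (IsCMField.complexConj L) (complexConj_imagUnit L) (imagUnit_ne_zero L)).toLinearEquiv.toAddEquiv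
      (quadraticLocalEquiv L v (IsCMField.complexConj L) (complexConj_imagUnit L) (imagUnit_ne_zero L) (a, b)) = a from fun a b => re_apply _ a b,
    show ∀ a b : v.adicCompletion (Fp L), im (quadraticLocalEquiv L v (IsCMField.complexConj L) (complexConj_imagUnit L) (imagUnit_ne_zero L)).toLinearEquiv.toAddEquiv
      (quadraticLocalEquiv L v (IsCMField.complexConj L) (complexConj_imagUnit L) (imagUnit_ne_zero L) (a, b)) = b from fun a b => im_apply _ a b]
  have h2 : (⅟(2 : v.adicCompletion (Fp L))) * 2 = 1 := invOf_mul_self _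
  linear_combination (-(η 3 * im (quadraticLocalEquiv L v (IsCMField.complexConj L) (complexConj_imagUnit L) (imagUnit_ne_zero L)).toLinearEquiv.toAddEquiv (G 0 1) +
    η 2 * re (quadraticLocalEquiv L v (IsCMField.complexConj L) (complexConj_imagUnit L) (imagUnit_ne_zero L)).toLinearEquiv.toAddEquiv (G 0 1))) * h2

include hdV0 hdW0 in
/-- **THE EXPONENT OF `nΔ η ⊗ 1` ON THE REAL FRAME IS `−η ⬝ᵥ qHerm`**: with `T_η = reindex epsV (t(η) ⊗ₖ 1)`, `⅟2 · β_Δ(R b, R (T_η b)) = −(η ⬝ᵥ qHerm (R b))`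
(★ p860927 `half_deltaGram_reFrame_tensor`, `S₀ t(η) = h(η)`, §2 duality, ★ p860905 `gramLoc_conjTranspose`∕`qHerm`). [cite: Kudla1994, §3 Thm. 3.1] [cite: Weil1964, n° 13] -/
theorem half_deltaGram_reFrame_tensor_tMat (η : Fin 4 → v.adicCompletion (Fp L)) (b : Fin n' → LocalRing L v) :
    ⅟(2 : v.adicCompletion (Fp L)) *
        Matrix.toLinearMap₂' (v.adicCompletion (Fp L))
          (deltaGram (e₂ n') ((gramR L e' dV hdV (tensorFrame L dW eW dV') (tensorFrame_real L dW hdW eW dV' hdV')).map (algebraMap (Fp L) (v.adicCompletion (Fp L)))))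
          (reFrame (Fp L) L (IsCMField.complexConj L) (complexConj_imagUnit L) (imagUnit_ne_zero L) v n' b)
          (reFrame (Fp L) L (IsCMField.complexConj L) (complexConj_imagUnit L) (imagUnit_ne_zero L) v n'
            (Matrix.reindex (epsV e eW e') (epsV e eW e') (tMat L e dV hdV dW hdW v η ⊗ₖ (1 : Matrix (Fin M₂) (Fin M₂) (LocalRing L v))) *ᵥ b)) =
      -(η ⬝ᵥ qHerm L (complexConj_imagUnit L) (imagUnit_ne_zero L) e eW e' dV' v
          (reFrame (Fp L) L (IsCMField.complexConj L) (complexConj_imagUnit L) (imagUnit_ne_zero L) v n' b)) := by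
  rw [half_deltaGram_reFrame_tensor L (complexConj_imagUnit L) (imagUnit_ne_zero L) (imagUnit_mul_self L) e dV hdV dW hdW eW e' dV' hdV' v,
    gramS_mul_tMat L e dV hdV hdV0 dW hdW hdW0 v,
    im_sum_hMat_mul L v η _ (gramLoc_conjTranspose L (complexConj_imagUnit L) (imagUnit_ne_zero L) eW e' dV' hdV' v e b), qHerm, LinearEquiv.symm_apply_apply]

end Summit.HodgeConjecture.HodgeConjecture.Cruxes.HLiu418.K2LiuA7ValueUnipotentPinsN

end
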